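import Mathlib
import Literature.Analysis.FluidPDE.Tao2016AveragedNS.SelfSimilarCascadeBlowup
import HarnessLib

/-!
# `OrthantWake.DyadicBreakBelowOne` — transport tools: the sign of the datum shell and the
# exponent bookkeeping of the weighted one-mode chain

Item stmt-NavierStokesRegularity-24644 (`OrthantWake.DyadicBreakBelowOne`, aside).  Two lemmas used
by `OrthantWakeDyadicBreakBelowOneTransport.lean`:

* `dyadicTransport_shellZero_sign` — the datum shell keeps its sign: `σ X_{0,0}(t) ≥ 0` on `[0,s]`
  (`σ = ±1` the sign of `X₀ 0`; `X_{0,0}²` is non-increasing since `Ẋ_{0,0} = −X_{0,0}(X_{0,1}+ν)`).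
* `dyadicTransport_identity` — the exponent bookkeeping: in the variables
  `Yₙ = b^{w(n−1)} a_{n−1}/R` (`a_k = X_{0,k}`, `a_0 = σ X_{0,0}`, `b = 1+ε₀`) the lattice equation is
  `Ẏₙ = -κₙ Yₙ + Fₙ (Y_{n-1}² − D Yₙ Y_{n+1})` with `κₙ = ν b^{2(n−1)}`,
  `Fₙ = R b^{(5/2−w)(n−1) − 5/2 + 2w}`, `D = b^{5/2−3w}` (and `F_{n+1}/Fₙ = b^{5/2−w}`, `κ_{n+1}/κₙ = b²`).

MODEL lattice statements (route OrthantWake, rung TL-M2Break); nothing here is a statement about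
the Navier–Stokes equations; no crux or summit is proved.
-/

noncomputable section

set_option linter.dupNamespace false

namespace Summit.NavierStokesRegularity.NavierStokesRegularity.Theorems

open Set Filter Topology
open Literature.Analysis.FluidPDE.TaoCascade

/-! ## The datum shell keeps its sign -/

/-- **Sign of the datum shell.** For a regular `ν`-viscous (`ν ≥ 0`) lattice solution of
`dyadicTable` on `[0,s]` that vanishes below shell `0` and is non-negative on the shells `≥ 1`,
`σ X_{0,0}(t) ≥ 0` on `[0,s]`, where `σ = 1` if `X₀ 0 ≥ 0` and `σ = −1` otherwise: indeed
`Ẋ_{0,0} = −X_{0,0}(X_{0,1} + ν)`, so `X_{0,0}²` is non-increasing and `X_{0,0}` cannot change sign.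
MODEL lattice statement. [this file] -/
theorem dyadicTransport_shellZero_sign {ε₀ ν s : ℝ} {X₀ : Fin 4 → ℝ} {X : Fin 4 → ℤ → ℝ → ℝ}
    (hε₀ : 0 < ε₀) (hν : 0 ≤ ν)
    (hinit : ∀ i k, X i k 0 = if k = 0 then X₀ i else 0)
    (hlow : ∀ i k, k < 0 → ∀ t, X i k t = 0)
    (hcont : ∀ i k, Continuous (X i k))
    (hder : ∀ i k, ∀ t ∈ Icc (0 : ℝ) s, HasDerivWithinAt (X i k)
      (quadTerm ε₀ dyadicTable X i k t - ν * (1 + ε₀) ^ ((2 : ℝ) * k) * X i k t) (Icc 0 s) t)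
    (hnonneg : ∀ t ∈ Icc (0 : ℝ) s, ∀ (i : Fin 4) (k : ℤ), 1 ≤ k → 0 ≤ X i k t) :
    ∀ t ∈ Icc (0 : ℝ) s, 0 ≤ (if 0 ≤ X₀ 0 then (1 : ℝ) else -1) * X 0 0 t := by
  have hb0 : (0 : ℝ) < 1 + ε₀ := by linarith
  -- the equation of the datum shell
  have hd0 : ∀ t ∈ Icc (0 : ℝ) s, HasDerivWithinAt (X 0 0)
      (-(X 0 0 t * (X 0 1 t + ν))) (Icc 0 s) t := by
    intro t ht
    have h := hder 0 0 t ht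
    rw [quadTerm_dyadicTable_zero] at h
    have hm1 : X 0 (0 - 1) t = 0 := hlow 0 (0 - 1) (by norm_num) t
    refine h.congr_deriv ?_
    rw [hm1]
    simp [Real.rpow_zero]
    ring
  -- `X_{0,0}²` is non-increasing on `[0,s]`
  set g : ℝ → ℝ := fun t => X 0 0 t * X 0 0 t with hg
  have hgd : ∀ t ∈ Icc (0 : ℝ) s, HasDerivWithinAt g
      (-(X 0 0 t * (X 0 1 t + ν)) * X 0 0 t + X 0 0 t * -(X 0 0 t * (X 0 1 t + ν)))
      (Icc 0 s) t := fun t ht => (hd0 t ht).mul (hd0 t ht)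
  have hanti : AntitoneOn g (Icc 0 s) := by
    apply antitoneOn_of_deriv_nonpos (convex_Icc 0 s)
    · exact ((hcont 0 0).mul (hcont 0 0)).continuousOn
    · intro t ht
      rw [interior_Icc] at ht
      exact ((hgd t ⟨ht.1.le, ht.2.le⟩).hasDerivAt (Icc_mem_nhds ht.1 ht.2)).differentiableAt
        |>.differentiableWithinAt
    · intro t ht
      rw [interior_Icc] at ht
      have hder' := (hgd t ⟨ht.1.le, ht.2.le⟩).hasDerivAt (Icc_mem_nhds ht.1 ht.2)
      rw [hder'.deriv]
      have h1 : 0 ≤ X 0 1 t := hnonneg t ⟨ht.1.le, ht.2.le⟩ 0 1 le_rfl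
      nlinarith [sq_nonneg (X 0 0 t)]
  -- no sign change
  set σ : ℝ := if 0 ≤ X₀ 0 then (1 : ℝ) else -1 with hσ
  have hσ0 : 0 ≤ σ * X 0 0 0 := by
    rw [hinit 0 0, if_pos rfl, hσ]
    split_ifs with h
    · linarith
    · push Not at h; nlinarith
  intro t ht
  by_contra hneg
  push Not at hneg
  -- by the intermediate value theorem there is `t₀ ∈ [0,t]` with `σ X_{0,0}(t₀) = 0`
  have hcg : ContinuousOn (fun u => σ * X 0 0 u) (Icc 0 t) :=
    (continuous_const.mul (hcont 0 0)).continuousOn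
  obtain ⟨t₀, ht₀, hzero⟩ : ∃ t₀ ∈ Icc (0 : ℝ) t, σ * X 0 0 t₀ = 0 :=
    intermediate_value_Icc' ht.1 hcg ⟨hneg.le, hσ0⟩
  have hσne : σ ≠ 0 := by rw [hσ]; split_ifs <;> norm_num
  have hX0 : X 0 0 t₀ = 0 := by
    rcases mul_eq_zero.1 hzero with h | h
    · exact absurd h hσne
    · exact h
  have hmono := hanti ⟨ht₀.1, ht₀.2.trans ht.2⟩ ht ht₀.2
  simp only [hg, hX0, mul_zero] at hmono
  have hXt : X 0 0 t = 0 := by nlinarith [mul_self_nonneg (X 0 0 t)]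
  rw [hXt, mul_zero] at hneg
  exact lt_irrefl _ hneg

/-! ## Exponent bookkeeping -/

/-- **The weighted chain is the abstract nearest-neighbour system** (pure exponent bookkeeping):
with `b > 0`, `R ≠ 0`, in the variables `Y = b^{wk} a_k / R` the `k`-th lattice equation
`ȧ_k = b^{5(k−1)/2} a_{k−1}² − b^{5k/2} a_k a_{k+1} − ν b^{2k} a_k`, multiplied by `b^{wk}/R`,
reads `-κ Y_k + F (Y_{k-1}² − D Y_k Y_{k+1})` with `κ = ν b^{2k}`,
`F = R b^{(5/2−w)k − 5/2 + 2w}`, `D = b^{5/2−3w}`. [this file] -/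
theorem dyadicTransport_identity {b R w ν P Q S : ℝ} (hb : 0 < b) (hR : R ≠ 0) (k : ℝ) :
    b ^ (w * k) * (b ^ ((5 : ℝ) * (k - 1) / 2) * P ^ 2 - b ^ ((5 : ℝ) * k / 2) * (Q * S) -
        ν * b ^ ((2 : ℝ) * k) * Q) / R =
      -(ν * b ^ ((2 : ℝ) * k)) * (b ^ (w * k) * Q / R) +
        R * b ^ (((5 : ℝ) / 2 - w) * k - 5 / 2 + 2 * w) *
          ((b ^ (w * (k - 1)) * P / R) ^ 2 -
            b ^ ((5 : ℝ) / 2 - 3 * w) * (b ^ (w * k) * Q / R) * (b ^ (w * (k + 1)) * S / R)) := by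
  have e2 : b ^ (w * k) * b ^ ((5 : ℝ) * (k - 1) / 2) =
      b ^ (((5 : ℝ) / 2 - w) * k - 5 / 2 + 2 * w) * (b ^ (w * (k - 1)) * b ^ (w * (k - 1))) := by
    rw [← Real.rpow_add hb, ← Real.rpow_add hb, ← Real.rpow_add hb]
    congr 1; ring
  have e3 : b ^ (w * k) * b ^ ((5 : ℝ) * k / 2) =
      b ^ (((5 : ℝ) / 2 - w) * k - 5 / 2 + 2 * w) * b ^ ((5 : ℝ) / 2 - 3 * w) * b ^ (w * k) *
        b ^ (w * (k + 1)) := by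
    rw [← Real.rpow_add hb, ← Real.rpow_add hb, ← Real.rpow_add hb, ← Real.rpow_add hb]
    congr 1; ring
  set A := b ^ (w * k) with hA
  set B := b ^ ((5 : ℝ) * (k - 1) / 2) with hB
  set C := b ^ ((5 : ℝ) * k / 2) with hC
  set G := b ^ ((2 : ℝ) * k) with hG
  set E := b ^ (((5 : ℝ) / 2 - w) * k - 5 / 2 + 2 * w) with hE
  set Am := b ^ (w * (k - 1)) with hAm
  set Ap := b ^ (w * (k + 1)) with hAp
  set Dd := b ^ ((5 : ℝ) / 2 - 3 * w) with hDd
  have hRi : R * R⁻¹ = 1 := mul_inv_cancel₀ hR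
  simp only [div_eq_mul_inv]
  linear_combination (P ^ 2 * R⁻¹) * e2 - (Q * S * R⁻¹) * e3 - (E * Am ^ 2 * P ^ 2 * R⁻¹) * hRi +
    (E * Dd * A * Ap * Q * S * R⁻¹) * hRi

end Summit.NavierStokesRegularity.NavierStokesRegularity.Theorems

end
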